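import Summits.CriticalPhenomena.SAWScalingLimit.Theorems.NoFoldBound.Negative.Ring12WalksAB

/-!
# `NoFoldBound` negative lemmas, holed witness IV: the hole-side mid-edge and the refutation

Part 4 of 4. The two walks to the hole-side mid-edge `{v, C}`, `C = (![-1,1],1) ∉ Λ₁₂` (windings
`±3`), the three values of `F` at `(x_c, 5/8)`:
`F{v,A} = x⁶e^{-5πi/12} + x⁷e^{5πi/24}`, `F{v,B} = conj`, `F{v,C} = 2x⁷cos(5π/8)`, the two modes
**`ring_sum_mode`**: `F_A + F_C + F_B = 2x⁶ cos(5π/12) · α_T` and **`ring_belt_mode`**: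
`(F_A + ωF_C + ω²F_B)·e^{iπ/3} = 2x⁶ cos(π/12) · β_T` (`α_T = 1 + 2x_c cos(5π/24)`,
`β_T = 1 + 2x_c cos(11π/24)`), the inequalities `α_T < 2β_T`, `2cos(5π/12) ≤ cos(π/12)`, and
**`noFoldBound_false_without_simplyConnected`**: the body of `NoFoldBound` with the hypothesis
`hexDomainSimplyConnected Λ` deleted is FALSE (ratio `cot(15°)·β_T/α_T = 2.2915…` at the antipode of
the 12-ring; DCS Lemma 1 still holds there, so a proof of `NoFoldBound` must use simple connectivity
beyond the vertex relation). Refuter: refuter-cdisprove-stmt-CriticalPhenomena-8296-0.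
-/

open Literature.Probability.LatticeModels Literature.Probability.RandomPlanarGeometry.SAW
open Literature.Probability.RandomPlanarGeometry.SAW.HV (omg omg_sq omg_add_one_ne_zero triZeta_eq_omg omg_pow_three
  two_mul_xc_mul_cos)

namespace Summit.CriticalPhenomena.SAWScalingLimit.Theorems.NoFoldBound.Negative

/-- Walk 1 to the mid-edge `{v, C}`: `[(0, 0, 0), (0, 0, 1), (0, 1, 0), (0, 1, 1), (0, 2, 0), (-1, 2, 1), (-1, 2, 0)]`. [folklore] -/
def walk_C1 : HexMidEdgeSAW Λ₁₂ srcR s((![-1, 2], 0), (![-1, 1], 1)) where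
  verts := [(![0, 0], 0), (![0, 0], 1), (![0, 1], 0), (![0, 1], 1), (![0, 2], 0), (![-1, 2], 1), (![-1, 2], 0)]
  subset := by decide
  nodup := by decide
  isChain := by decide
  head_mem := by intro w hw; simp only [List.head?_cons, Option.some.injEq] at hw; subst hw; simp [srcR]
  getLast_mem := by intro w hw; simp at hw; subst hw; simp
  eq_of_nil := by intro h; simp at h
  edges_nodup := by intro _; decide
  fst_mem := hexDomainBoundary_subset _ srcR_mem_boundary

/-- Walk 2 to the mid-edge `{v, C}`: `[(0, 0, 0), (-1, 0, 1), (-1, 1, 0), (-2, 1, 1), (-2, 2, 0), (-2, 2, 1), (-1, 2, 0)]`. [folklore] -/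
def walk_C2 : HexMidEdgeSAW Λ₁₂ srcR s((![-1, 2], 0), (![-1, 1], 1)) where
  verts := [(![0, 0], 0), (![-1, 0], 1), (![-1, 1], 0), (![-2, 1], 1), (![-2, 2], 0), (![-2, 2], 1), (![-1, 2], 0)]
  subset := by decide
  nodup := by decide
  isChain := by decide
  head_mem := by intro w hw; simp only [List.head?_cons, Option.some.injEq] at hw; subst hw; simp [srcR]
  getLast_mem := by intro w hw; simp at hw; subst hw; simp
  eq_of_nil := by intro h; simp at h
  edges_nodup := by intro _; decide
  fst_mem := hexDomainBoundary_subset _ srcR_mem_boundary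

/-- The walks of `Λ₁₂` from `srcR` to the mid-edge `{v, C}` are exactly `walk_C1`, `walk_C2`. [folklore] -/
theorem verts_cases_C (γ : HexMidEdgeSAW Λ₁₂ srcR s((![-1, 2], 0), (![-1, 1], 1))) :
    γ.verts = [(![0, 0], 0), (![0, 0], 1), (![0, 1], 0), (![0, 1], 1), (![0, 2], 0), (![-1, 2], 1), (![-1, 2], 0)] ∨ γ.verts = [(![0, 0], 0), (![-1, 0], 1), (![-1, 1], 0), (![-2, 1], 1), (![-2, 2], 0), (![-2, 2], 1), (![-1, 2], 0)] := by
  have hne : γ.verts ≠ [] := fun h => absurd (γ.eq_of_nil h) (by decide)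
  have hm := verts_mem_ringPrefixes γ hne
  simp only [ringPrefixes, List.mem_append, List.mem_map, List.mem_range] at hm
  obtain ⟨k, hk, hk'⟩ | ⟨k, hk, hk'⟩ := hm
  · interval_cases k
    · -- ringD1, k = 0, last (0, 0, 0): notlast
      exfalso
      have h := γ.getLast_mem (![0, 0], 0) (by rw [← hk']; rfl)
      exact absurd h (by decide)
    · -- ringD1, k = 1, last (0, 0, 1): notlast
      exfalso
      have h := γ.getLast_mem (![0, 0], 1) (by rw [← hk']; rfl)
      exact absurd h (by decide)
    · -- ringD1, k = 2, last (0, 1, 0): notlast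
      exfalso
      have h := γ.getLast_mem (![0, 1], 0) (by rw [← hk']; rfl)
      exact absurd h (by decide)
    · -- ringD1, k = 3, last (0, 1, 1): notlast
      exfalso
      have h := γ.getLast_mem (![0, 1], 1) (by rw [← hk']; rfl)
      exact absurd h (by decide)
    · -- ringD1, k = 4, last (0, 2, 0): notlast
      exfalso
      have h := γ.getLast_mem (![0, 2], 0) (by rw [← hk']; rfl)
      exact absurd h (by decide)
    · -- ringD1, k = 5, last (-1, 2, 1): notlast
      exfalso
      have h := γ.getLast_mem (![-1, 2], 1) (by rw [← hk']; rfl)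
      exact absurd h (by decide)
    · -- ringD1, k = 6, last (-1, 2, 0): ok1
      left; rw [← hk']; rfl
    · -- ringD1, k = 7, last (-2, 2, 1): notlast
      exfalso
      have h := γ.getLast_mem (![-2, 2], 1) (by rw [← hk']; rfl)
      exact absurd h (by decide)
    · -- ringD1, k = 8, last (-2, 2, 0): notlast
      exfalso
      have h := γ.getLast_mem (![-2, 2], 0) (by rw [← hk']; rfl)
      exact absurd h (by decide)
    · -- ringD1, k = 9, last (-2, 1, 1): notlast
      exfalso
      have h := γ.getLast_mem (![-2, 1], 1) (by rw [← hk']; rfl)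
      exact absurd h (by decide)
    · -- ringD1, k = 10, last (-1, 1, 0): notlast
      exfalso
      have h := γ.getLast_mem (![-1, 1], 0) (by rw [← hk']; rfl)
      exact absurd h (by decide)
    · -- ringD1, k = 11, last (-1, 0, 1): notlast
      exfalso
      have h := γ.getLast_mem (![-1, 0], 1) (by rw [← hk']; rfl)
      exact absurd h (by decide)
  · interval_cases k
    · -- ringD2, k = 0, last (0, 0, 0): notlast
      exfalso
      have h := γ.getLast_mem (![0, 0], 0) (by rw [← hk']; rfl)
      exact absurd h (by decide)
    · -- ringD2, k = 1, last (-1, 0, 1): notlast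
      exfalso
      have h := γ.getLast_mem (![-1, 0], 1) (by rw [← hk']; rfl)
      exact absurd h (by decide)
    · -- ringD2, k = 2, last (-1, 1, 0): notlast
      exfalso
      have h := γ.getLast_mem (![-1, 1], 0) (by rw [← hk']; rfl)
      exact absurd h (by decide)
    · -- ringD2, k = 3, last (-2, 1, 1): notlast
      exfalso
      have h := γ.getLast_mem (![-2, 1], 1) (by rw [← hk']; rfl)
      exact absurd h (by decide)
    · -- ringD2, k = 4, last (-2, 2, 0): notlast
      exfalso
      have h := γ.getLast_mem (![-2, 2], 0) (by rw [← hk']; rfl)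
      exact absurd h (by decide)
    · -- ringD2, k = 5, last (-2, 2, 1): notlast
      exfalso
      have h := γ.getLast_mem (![-2, 2], 1) (by rw [← hk']; rfl)
      exact absurd h (by decide)
    · -- ringD2, k = 6, last (-1, 2, 0): ok2
      right; rw [← hk']; rfl
    · -- ringD2, k = 7, last (-1, 2, 1): notlast
      exfalso
      have h := γ.getLast_mem (![-1, 2], 1) (by rw [← hk']; rfl)
      exact absurd h (by decide)
    · -- ringD2, k = 8, last (0, 2, 0): notlast
      exfalso
      have h := γ.getLast_mem (![0, 2], 0) (by rw [← hk']; rfl)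
      exact absurd h (by decide)
    · -- ringD2, k = 9, last (0, 1, 1): notlast
      exfalso
      have h := γ.getLast_mem (![0, 1], 1) (by rw [← hk']; rfl)
      exact absurd h (by decide)
    · -- ringD2, k = 10, last (0, 1, 0): notlast
      exfalso
      have h := γ.getLast_mem (![0, 1], 0) (by rw [← hk']; rfl)
      exact absurd h (by decide)
    · -- ringD2, k = 11, last (0, 0, 1): notlast
      exfalso
      have h := γ.getLast_mem (![0, 0], 1) (by rw [← hk']; rfl)
      exact absurd h (by decide)

/-- The two walks differ. [folklore] -/
theorem walk_C1_ne_walk_C2 : walk_C1 ≠ walk_C2 := fun h => by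
  have := congrArg HexMidEdgeSAW.verts h; exact absurd this (by decide)

/-- `F{v,C}` is the sum of the weights of the two walks. [folklore] -/
theorem observable_C (x σ : ℝ) : hexParafermionicObservable Λ₁₂ srcR x σ s((![-1, 2], 0), (![-1, 1], 1)) =
    walk_C1.weight x σ + walk_C2.weight x σ := by
  rw [hexParafermionicObservable]
  refine Finset.sum_eq_add walk_C1 walk_C2 walk_C1_ne_walk_C2 (fun γ _ hγ => ?_) (by simp) (by simp)
  exfalso
  rcases verts_cases_C γ with h | h
  · exact hγ.1 (HexMidEdgeSAW.ext h)
  · exact hγ.2 (HexMidEdgeSAW.ext h)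

/-- Winding of `walk_C1`: `3 · (π/3)`. [folklore] -/
theorem winding_walk_C1 : walk_C1.winding = (3 : ℝ) * (Real.pi / 3) := by
  simp only [HexMidEdgeSAW.winding, HexMidEdgeSAW.points, walk_C1, srcR, List.map_cons, List.map_nil,
    List.cons_append, List.nil_append, winding_cons_cons_cons, winding_pair,
    turn_00, turn_01, turn_02, turn_03, turn_04, turn_13, turn_16]
  ring

/-- Weight of `walk_C1`: `e^{-iσ·3π/3} x^7`. [folklore] -/
theorem weight_walk_C1 (x σ : ℝ) : walk_C1.weight x σ =
    Complex.exp (-Complex.I * σ * (((3 : ℝ) * (Real.pi / 3) : ℝ) : ℂ)) * (x : ℂ) ^ 7 := by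
  rw [HexMidEdgeSAW.weight, winding_walk_C1]; rfl

/-- Winding of `walk_C2`: `-3 · (π/3)`. [folklore] -/
theorem winding_walk_C2 : walk_C2.winding = (-3 : ℝ) * (Real.pi / 3) := by
  simp only [HexMidEdgeSAW.winding, HexMidEdgeSAW.points, walk_C2, srcR, List.map_cons, List.map_nil,
    List.cons_append, List.nil_append, winding_cons_cons_cons, winding_pair,
    turn_06, turn_07, turn_08, turn_09, turn_10, turn_11, turn_17]
  ring

/-- Weight of `walk_C2`: `e^{-iσ·-3π/3} x^7`. [folklore] -/
theorem weight_walk_C2 (x σ : ℝ) : walk_C2.weight x σ =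
    Complex.exp (-Complex.I * σ * (((-3 : ℝ) * (Real.pi / 3) : ℝ) : ℂ)) * (x : ℂ) ^ 7 := by
  rw [HexMidEdgeSAW.weight, winding_walk_C2]; rfl

/-! ### The observable at the antipode at `x = x_c`, `σ = 5/8`, the two modes, and the refutation -/


/-- A value of the observable at the antipode of the 12-ring. [folklore] -/
theorem FA_eq : hexParafermionicObservable Λ₁₂ srcR hexCriticalFugacity (5 / 8) s((![-1, 2], 0), (![-1, 2], 1)) =
    (hexCriticalFugacity : ℂ) ^ 6 * Complex.exp (-((5 * Real.pi / 12 : ℝ) : ℂ) * Complex.I) +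
    (hexCriticalFugacity : ℂ) ^ 7 * Complex.exp (((5 * Real.pi / 24 : ℝ) : ℂ) * Complex.I) := by
  rw [observable_A, weight_walk_A1, weight_walk_A2]
  congr 1
  · rw [mul_comm]; congr 1; congr 1; push_cast; ring
  · rw [mul_comm]; congr 1; congr 1; push_cast; ring

/-- A value of the observable at the antipode of the 12-ring. [folklore] -/
theorem FB_eq : hexParafermionicObservable Λ₁₂ srcR hexCriticalFugacity (5 / 8) s((![-1, 2], 0), (![-2, 2], 1)) =
    (hexCriticalFugacity : ℂ) ^ 7 * Complex.exp (-((5 * Real.pi / 24 : ℝ) : ℂ) * Complex.I) +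
    (hexCriticalFugacity : ℂ) ^ 6 * Complex.exp (((5 * Real.pi / 12 : ℝ) : ℂ) * Complex.I) := by
  rw [observable_B, weight_walk_B1, weight_walk_B2]
  congr 1
  · rw [mul_comm]; congr 1; congr 1; push_cast; ring
  · rw [mul_comm]; congr 1; congr 1; push_cast; ring

/-- A value of the observable at the antipode of the 12-ring. [folklore] -/
theorem FC_eq : hexParafermionicObservable Λ₁₂ srcR hexCriticalFugacity (5 / 8) s((![-1, 2], 0), (![-1, 1], 1)) =
    (hexCriticalFugacity : ℂ) ^ 7 * Complex.exp (-((5 * Real.pi / 8 : ℝ) : ℂ) * Complex.I) +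
    (hexCriticalFugacity : ℂ) ^ 7 * Complex.exp (((5 * Real.pi / 8 : ℝ) : ℂ) * Complex.I) := by
  rw [observable_C, weight_walk_C1, weight_walk_C2]
  congr 1
  · rw [mul_comm]; congr 1; congr 1; push_cast; ring
  · rw [mul_comm]; congr 1; congr 1; push_cast; ring

/-- **Sum mode at the antipode**: `F_A + F_C + F_B = 2 x_c⁶ cos(5π/12) · α_T`. [folklore] -/
theorem ring_sum_mode : hexParafermionicObservable Λ₁₂ srcR hexCriticalFugacity (5 / 8) s((![-1, 2], 0), (![-1, 2], 1)) + hexParafermionicObservable Λ₁₂ srcR hexCriticalFugacity (5 / 8) s((![-1, 2], 0), (![-1, 1], 1)) +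
    hexParafermionicObservable Λ₁₂ srcR hexCriticalFugacity (5 / 8) s((![-1, 2], 0), (![-2, 2], 1)) =
    ((2 * hexCriticalFugacity ^ 6 * Real.cos (5 * Real.pi / 12) *
      (1 + 2 * hexCriticalFugacity * Real.cos (5 * Real.pi / 24)) : ℝ) : ℂ) := by
  rw [FA_eq, FB_eq, FC_eq]
  have h1 := Complex.two_cos ((5 * Real.pi / 24 : ℝ) : ℂ)
  have h2 := Complex.two_cos ((5 * Real.pi / 12 : ℝ) : ℂ)
  have p1 : Complex.exp (((5 * Real.pi / 12 : ℝ) : ℂ) * Complex.I) * Complex.exp (((5 * Real.pi / 24 : ℝ) : ℂ) * Complex.I)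
      = Complex.exp (((5 * Real.pi / 8 : ℝ) : ℂ) * Complex.I) := by
    rw [← Complex.exp_add]; congr 1; push_cast; ring
  have p2 : Complex.exp (((5 * Real.pi / 12 : ℝ) : ℂ) * Complex.I) * Complex.exp (-((5 * Real.pi / 24 : ℝ) : ℂ) * Complex.I)
      = Complex.exp (((5 * Real.pi / 24 : ℝ) : ℂ) * Complex.I) := by
    rw [← Complex.exp_add]; congr 1; push_cast; ring
  have p3 : Complex.exp (-((5 * Real.pi / 12 : ℝ) : ℂ) * Complex.I) * Complex.exp (((5 * Real.pi / 24 : ℝ) : ℂ) * Complex.I)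
      = Complex.exp (-((5 * Real.pi / 24 : ℝ) : ℂ) * Complex.I) := by
    rw [← Complex.exp_add]; congr 1; push_cast; ring
  have p4 : Complex.exp (-((5 * Real.pi / 12 : ℝ) : ℂ) * Complex.I) * Complex.exp (-((5 * Real.pi / 24 : ℝ) : ℂ) * Complex.I)
      = Complex.exp (-((5 * Real.pi / 8 : ℝ) : ℂ) * Complex.I) := by
    rw [← Complex.exp_add]; congr 1; push_cast; ring
  have hprod : (2 * Complex.cos ((5 * Real.pi / 12 : ℝ) : ℂ)) * (2 * Complex.cos ((5 * Real.pi / 24 : ℝ) : ℂ)) =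
      Complex.exp (((5 * Real.pi / 8 : ℝ) : ℂ) * Complex.I) + Complex.exp (((5 * Real.pi / 24 : ℝ) : ℂ) * Complex.I) +
      Complex.exp (-((5 * Real.pi / 24 : ℝ) : ℂ) * Complex.I) + Complex.exp (-((5 * Real.pi / 8 : ℝ) : ℂ) * Complex.I) := by
    rw [h1, h2]; linear_combination p1 + p2 + p3 + p4
  push_cast at h2 hprod ⊢
  linear_combination (-(hexCriticalFugacity : ℂ) ^ 6) * h2 - (hexCriticalFugacity : ℂ) ^ 7 * hprod

/-- **Beltrami mode at the antipode** (labelling `A, C, B`), rotated by `e^{iπ/3}`: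
`(F_A + ω F_C + ω² F_B) e^{iπ/3} = 2 x_c⁶ cos(π/12) · β_T`. [folklore] -/
theorem ring_belt_mode : (hexParafermionicObservable Λ₁₂ srcR hexCriticalFugacity (5 / 8) s((![-1, 2], 0), (![-1, 2], 1)) +
    Complex.exp (2 * Real.pi * Complex.I / 3) * hexParafermionicObservable Λ₁₂ srcR hexCriticalFugacity (5 / 8) s((![-1, 2], 0), (![-1, 1], 1)) +
    Complex.exp (2 * Real.pi * Complex.I / 3) ^ 2 * hexParafermionicObservable Λ₁₂ srcR hexCriticalFugacity (5 / 8) s((![-1, 2], 0), (![-2, 2], 1))) *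
    Complex.exp (((Real.pi / 3 : ℝ) : ℂ) * Complex.I) =
    ((2 * hexCriticalFugacity ^ 6 * Real.cos (Real.pi / 12) *
      (1 + 2 * hexCriticalFugacity * Real.cos (11 * Real.pi / 24)) : ℝ) : ℂ) := by
  rw [FA_eq, FB_eq, FC_eq]
  have q1 : Complex.exp (-((5 * Real.pi / 12 : ℝ) : ℂ) * Complex.I) * Complex.exp (((Real.pi / 3 : ℝ) : ℂ) * Complex.I)
      = Complex.exp (-((Real.pi / 12 : ℝ) : ℂ) * Complex.I) := by
    rw [← Complex.exp_add]; congr 1; push_cast; ring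
  have q2 : Complex.exp (2 * Real.pi * Complex.I / 3) ^ 2 * Complex.exp (((5 * Real.pi / 12 : ℝ) : ℂ) * Complex.I) *
      Complex.exp (((Real.pi / 3 : ℝ) : ℂ) * Complex.I) = Complex.exp (((Real.pi / 12 : ℝ) : ℂ) * Complex.I) := by
    rw [sq, ← Complex.exp_add, ← Complex.exp_add, ← Complex.exp_add,
      show 2 * (Real.pi : ℂ) * Complex.I / 3 + 2 * Real.pi * Complex.I / 3 + ((5 * Real.pi / 12 : ℝ) : ℂ) * Complex.I +
        ((Real.pi / 3 : ℝ) : ℂ) * Complex.I = ((Real.pi / 12 : ℝ) : ℂ) * Complex.I + 2 * Real.pi * Complex.I by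
        push_cast; ring, Complex.exp_add, Complex.exp_two_pi_mul_I, mul_one]
  have q3 : Complex.exp (((5 * Real.pi / 24 : ℝ) : ℂ) * Complex.I) * Complex.exp (((Real.pi / 3 : ℝ) : ℂ) * Complex.I)
      = Complex.exp (((13 * Real.pi / 24 : ℝ) : ℂ) * Complex.I) := by
    rw [← Complex.exp_add]; congr 1; push_cast; ring
  have q4 : Complex.exp (2 * Real.pi * Complex.I / 3) ^ 2 * Complex.exp (-((5 * Real.pi / 24 : ℝ) : ℂ) * Complex.I) *
      Complex.exp (((Real.pi / 3 : ℝ) : ℂ) * Complex.I) = Complex.exp (-((13 * Real.pi / 24 : ℝ) : ℂ) * Complex.I) := by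
    rw [sq, ← Complex.exp_add, ← Complex.exp_add, ← Complex.exp_add,
      show 2 * (Real.pi : ℂ) * Complex.I / 3 + 2 * Real.pi * Complex.I / 3 + -((5 * Real.pi / 24 : ℝ) : ℂ) * Complex.I +
        ((Real.pi / 3 : ℝ) : ℂ) * Complex.I = -((13 * Real.pi / 24 : ℝ) : ℂ) * Complex.I + 2 * Real.pi * Complex.I by
        push_cast; ring, Complex.exp_add, Complex.exp_two_pi_mul_I, mul_one]
  have q5 : Complex.exp (2 * Real.pi * Complex.I / 3) * Complex.exp (-((5 * Real.pi / 8 : ℝ) : ℂ) * Complex.I) *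
      Complex.exp (((Real.pi / 3 : ℝ) : ℂ) * Complex.I) = Complex.exp (((9 * Real.pi / 24 : ℝ) : ℂ) * Complex.I) := by
    rw [← Complex.exp_add, ← Complex.exp_add]; congr 1; push_cast; ring
  have q6 : Complex.exp (2 * Real.pi * Complex.I / 3) * Complex.exp (((5 * Real.pi / 8 : ℝ) : ℂ) * Complex.I) *
      Complex.exp (((Real.pi / 3 : ℝ) : ℂ) * Complex.I) = Complex.exp (-((9 * Real.pi / 24 : ℝ) : ℂ) * Complex.I) := by
    rw [← Complex.exp_add, ← Complex.exp_add,
      show 2 * (Real.pi : ℂ) * Complex.I / 3 + ((5 * Real.pi / 8 : ℝ) : ℂ) * Complex.I + ((Real.pi / 3 : ℝ) : ℂ) * Complex.I =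
        -((9 * Real.pi / 24 : ℝ) : ℂ) * Complex.I + 2 * Real.pi * Complex.I by push_cast; ring,
      Complex.exp_add, Complex.exp_two_pi_mul_I, mul_one]
  have c1 := Complex.two_cos ((Real.pi / 12 : ℝ) : ℂ)
  have c2 := Complex.two_cos ((13 * Real.pi / 24 : ℝ) : ℂ)
  have c3 := Complex.two_cos ((9 * Real.pi / 24 : ℝ) : ℂ)
  have cc : Real.cos (13 * Real.pi / 24) + Real.cos (9 * Real.pi / 24) =
      2 * Real.cos (11 * Real.pi / 24) * Real.cos (Real.pi / 12) := by
    rw [Real.cos_add_cos]; congr 2 <;> ring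
  have cc' := congrArg (fun r : ℝ => (r : ℂ)) cc
  push_cast at q1 q2 q3 q4 q5 q6 c1 c2 c3 cc' ⊢
  linear_combination (hexCriticalFugacity : ℂ) ^ 6 * q1 + (hexCriticalFugacity : ℂ) ^ 6 * q2 +
    (hexCriticalFugacity : ℂ) ^ 7 * q3 + (hexCriticalFugacity : ℂ) ^ 7 * q4 + (hexCriticalFugacity : ℂ) ^ 7 * q5 +
    (hexCriticalFugacity : ℂ) ^ 7 * q6 - (hexCriticalFugacity : ℂ) ^ 6 * c1 - (hexCriticalFugacity : ℂ) ^ 7 * c2 -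
    (hexCriticalFugacity : ℂ) ^ 7 * c3 + 2 * (hexCriticalFugacity : ℂ) ^ 7 * cc'


/-- `α_T < 2 β_T` (from `2 x_c cos(π/8) = 1` and `cos(5π/24) < cos(π/8)`). [folklore] -/
theorem nfb_alphaT_lt_two_betaT' : 1 + 2 * hexCriticalFugacity * Real.cos (5 * Real.pi / 24) <
    2 * (1 + 2 * hexCriticalFugacity * Real.cos (11 * Real.pi / 24)) := by
  have hc : 0 ≤ Real.cos (11 * Real.pi / 24) := Real.cos_nonneg_of_mem_Icc
    ⟨by linarith [Real.pi_pos], by linarith [Real.pi_pos]⟩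
  have hx : 0 < hexCriticalFugacity := by rw [hexCriticalFugacity]; positivity
  have hlt : Real.cos (5 * Real.pi / 24) < Real.cos (Real.pi / 8) :=
    Real.cos_lt_cos_of_nonneg_of_le_pi_div_two (by linarith [Real.pi_pos])
      (by linarith [Real.pi_pos]) (by linarith [Real.pi_pos])
  have h1 := two_mul_xc_mul_cos
  nlinarith

/-- `2 cos(5π/12) ≤ cos(π/12)` (numerically `0.518 ≤ 0.966`). [folklore] -/
theorem two_cos_five_pi_div_twelve_le : 2 * Real.cos (5 * Real.pi / 12) ≤ Real.cos (Real.pi / 12) := by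
  have hpi := Real.pi_lt_d2
  have hpi' := Real.pi_gt_three
  have hs : Real.cos (5 * Real.pi / 12) = Real.sin (Real.pi / 12) := by
    rw [← Real.cos_pi_div_two_sub]; congr 1; ring
  have h1 : Real.sin (Real.pi / 12) ≤ Real.pi / 12 := Real.sin_le (by positivity)
  have h2 : 1 - (Real.pi / 12) ^ 2 / 2 ≤ Real.cos (Real.pi / 12) := Real.one_sub_sq_div_two_le_cos
  rw [hs]
  nlinarith

/-- **`NoFoldBound` is FALSE without simple connectivity**: on the 12-ring `Λ₁₂` around one
missing vertex, with the source on the outer boundary, the antipodal vertex `v = (![-1,2],0)`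
(adjacent to the hole) has `|Beltrami| / |sum| = cot(15°) · β_T/α_T = 2.2915… > 1`: exactly,
`sum = 2x_c⁶ cos(5π/12) α_T` and `|Beltrami| = 2x_c⁶ cos(π/12) β_T` (`α_T = 1 + 2x_c cos(5π/24)`,
`β_T = 1 + 2x_c cos(11π/24)`, and `α_T < 2β_T`, `2cos(5π/12) ≤ cos(π/12)`). The two ways round the
hole superpose at the antipode with windings `±75°`, `±37.5°`, `±112.5°` — the incoherence simple
connectivity forbids; DCS Lemma 1 still holds at `v`, so any proof of `NoFoldBound` must use
`hexDomainSimplyConnected` beyond the vertex relation. [folklore] -/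
theorem noFoldBound_false_without_simplyConnected : ¬ (
    ∃ k : ℝ, k < 1 ∧ ∀ (Λ : Finset HexVertex), ∀ a ∈ hexDomainBoundary Λ, ∀ v ∈ Λ,
      ∀ w₀ w₁ w₂ : HexVertex, hexGraph.Adj v w₀ → hexGraph.Adj v w₁ → hexGraph.Adj v w₂ →
      w₀ ≠ w₁ → w₁ ≠ w₂ → w₀ ≠ w₂ →
      let F : Sym2 HexVertex → ℂ := hexParafermionicObservable Λ a hexCriticalFugacity (5 / 8)
      let ω : ℂ := Complex.exp (2 * Real.pi * Complex.I / 3)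
      ‖F s(v, w₀) + ω * F s(v, w₁) + ω ^ 2 * F s(v, w₂)‖ ≤ k * ‖F s(v, w₀) + F s(v, w₁) + F s(v, w₂)‖) := by
  rintro ⟨k, hk, h⟩
  have h1 := h Λ₁₂ srcR srcR_mem_boundary (![-1, 2], 0) (by decide) (![-1, 2], 1) (![-1, 1], 1) (![-2, 2], 1)
    (by decide) (by decide) (by decide) (by decide) (by decide) (by decide)
  dsimp only at h1
  have hx : 0 < hexCriticalFugacity := by rw [hexCriticalFugacity]; positivity
  have hcos5 : 0 ≤ Real.cos (5 * Real.pi / 24) :=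
    Real.cos_nonneg_of_mem_Icc ⟨by linarith [Real.pi_pos], by linarith [Real.pi_pos]⟩
  have hcos11 : 0 ≤ Real.cos (11 * Real.pi / 24) :=
    Real.cos_nonneg_of_mem_Icc ⟨by linarith [Real.pi_pos], by linarith [Real.pi_pos]⟩
  have hcos12 : 0 < Real.cos (5 * Real.pi / 12) :=
    Real.cos_pos_of_mem_Ioo ⟨by linarith [Real.pi_pos], by linarith [Real.pi_pos]⟩
  have hcos1 : 0 ≤ Real.cos (Real.pi / 12) :=
    Real.cos_nonneg_of_mem_Icc ⟨by linarith [Real.pi_pos], by linarith [Real.pi_pos]⟩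
  have hα : 0 < 1 + 2 * hexCriticalFugacity * Real.cos (5 * Real.pi / 24) := by positivity
  have hβ : 0 ≤ 1 + 2 * hexCriticalFugacity * Real.cos (11 * Real.pi / 24) := by positivity
  -- the norm of the sum mode
  have hS : ‖hexParafermionicObservable Λ₁₂ srcR hexCriticalFugacity (5 / 8) s((![-1, 2], 0), (![-1, 2], 1)) +
      hexParafermionicObservable Λ₁₂ srcR hexCriticalFugacity (5 / 8) s((![-1, 2], 0), (![-1, 1], 1)) +
      hexParafermionicObservable Λ₁₂ srcR hexCriticalFugacity (5 / 8) s((![-1, 2], 0), (![-2, 2], 1))‖ =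
      2 * hexCriticalFugacity ^ 6 * Real.cos (5 * Real.pi / 12) *
        (1 + 2 * hexCriticalFugacity * Real.cos (5 * Real.pi / 24)) := by
    rw [ring_sum_mode, Complex.norm_real, Real.norm_of_nonneg (by positivity)]
  -- the norm of the Beltrami mode
  have hB : ‖hexParafermionicObservable Λ₁₂ srcR hexCriticalFugacity (5 / 8) s((![-1, 2], 0), (![-1, 2], 1)) +
      Complex.exp (2 * Real.pi * Complex.I / 3) *
        hexParafermionicObservable Λ₁₂ srcR hexCriticalFugacity (5 / 8) s((![-1, 2], 0), (![-1, 1], 1)) +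
      Complex.exp (2 * Real.pi * Complex.I / 3) ^ 2 *
        hexParafermionicObservable Λ₁₂ srcR hexCriticalFugacity (5 / 8) s((![-1, 2], 0), (![-2, 2], 1))‖ =
      2 * hexCriticalFugacity ^ 6 * Real.cos (Real.pi / 12) *
        (1 + 2 * hexCriticalFugacity * Real.cos (11 * Real.pi / 24)) := by
    have e := ring_belt_mode
    have hn := congrArg (fun z : ℂ => ‖z‖) e
    rw [norm_mul, Complex.norm_exp_ofReal_mul_I, mul_one, Complex.norm_real,
      Real.norm_of_nonneg (by positivity)] at hn
    exact hn
  rw [hS, hB] at h1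
  have hαβ := nfb_alphaT_lt_two_betaT'
  have hc := two_cos_five_pi_div_twelve_le
  have hx6 : 0 < hexCriticalFugacity ^ 6 := by positivity
  -- h1 : 2x⁶ cos(π/12) β ≤ k · 2x⁶ cos(5π/12) α, with k < 1, α < 2β, 2cos(5π/12) ≤ cos(π/12): contradiction
  have hlt : k * (2 * hexCriticalFugacity ^ 6 * Real.cos (5 * Real.pi / 12) *
      (1 + 2 * hexCriticalFugacity * Real.cos (5 * Real.pi / 24))) <
      2 * hexCriticalFugacity ^ 6 * Real.cos (5 * Real.pi / 12) *
        (1 + 2 * hexCriticalFugacity * Real.cos (5 * Real.pi / 24)) := by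
    have hpos : 0 < 2 * hexCriticalFugacity ^ 6 * Real.cos (5 * Real.pi / 12) *
        (1 + 2 * hexCriticalFugacity * Real.cos (5 * Real.pi / 24)) := by positivity
    nlinarith
  have key : 2 * hexCriticalFugacity ^ 6 * Real.cos (5 * Real.pi / 12) *
      (1 + 2 * hexCriticalFugacity * Real.cos (5 * Real.pi / 24)) ≤
      2 * hexCriticalFugacity ^ 6 * Real.cos (Real.pi / 12) *
        (1 + 2 * hexCriticalFugacity * Real.cos (11 * Real.pi / 24)) := by
    have : Real.cos (5 * Real.pi / 12) * (1 + 2 * hexCriticalFugacity * Real.cos (5 * Real.pi / 24)) ≤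
        Real.cos (Real.pi / 12) * (1 + 2 * hexCriticalFugacity * Real.cos (11 * Real.pi / 24)) := by
      nlinarith
    nlinarith
  linarith

end Summit.CriticalPhenomena.SAWScalingLimit.Theorems.NoFoldBound.Negative
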